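import Literature.Analysis.FluidPDE.NecasRuzickaSverakEpsilon
import Literature.Analysis.FluidPDE.TsaiSelfSimilarPressureProofs
import HarnessLib

/-!
# Nečas–Růžička–Šverák 1996, Lemma 3.1: the `L^{3/2}` pressure from the Riesz transforms

Analysis/FluidPDE file (family NS, statement ns.S21), third layer of the decomposition of the
named fact `Literature.Analysis.FluidPDE.necas_ruzicka_sverak` (`SelfSimilarLiouville.lean`;
J. Nečas, M. Růžička, V. Šverák, Acta Math. 176 (1996) 283–294, Theorem 1). The second layer
(`NecasRuzickaSverakEpsilon.lean`) reduced Theorem 1 to the regularity of profiles, Tsai's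
pressure growth, the one-scale ε-regularity criterion and NRŠ's **Lemma 3.1**
(`nrs1996_lemma31`: an `L³` profile has a constant `c` with `P − c ∈ L^{3/2}`). This file splits
Lemma 3.1 into its harmonic-analysis half and its Liouville half and **proves the latter**:

* `nrs1996_rieszPressure` — **named fact**, pure Calderón–Zygmund theory (NRŠ §2, p. 285:
  "From the classical results regarding the operators `Rⱼ` (see e.g. [CZ] or [St]) we infer that
  `P` defined by `P = RⱼRₖ(UⱼUₖ)` satisfies `‖P‖_{L^q(ℝⁿ)} ≤ C_q ‖U‖²_{L^{2q}(ℝⁿ)}` and solves (2.2)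
  in the sense of distributions"): for `1 < q < ∞` and `U` with `∫ |U|^{2q} < ∞` there is `Q`
  with `∫ |Q|^q ≤ C ∫ |U|^{2q}` and `−ΔQ = ∂ⱼ∂ₖ(UⱼUₖ)` in `𝒟'(ℝ³)` — the unweighted twin of the
  sibling fact `tsai1998_weightedRieszPressure`;
* `IsLerayProfile.exists_sub_ae_eq_const_L3` — **proved** (NRŠ's proof of (3.1), pp. 287–288,
  in Tsai's form, Lemma 2.1 of ARMA 143 (1998), pp. 35–36): for a Leray profile `(U, P)` with
  `∫ |U|³ < ∞` and any `Q ∈ L^{3/2}` solving the pressure Poisson equation weakly, `P − Q` is a.e.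
  a constant (mollify `P − Q`, which is weakly harmonic; the gradient of the mollification is an
  integral against a probe of radius `R`, bounded by `K R^{-2/5}` through Hölder on balls with
  `U ∈ L³`, `|U|² ∈ L^{3/2}`, `Q ∈ L^{3/2}`; let `R → ∞`; Lebesgue differentiation);
* `nrs1996_lemma31_of_rieszPressure : nrs1996_rieszPressure → nrs1996_lemma31` — **proved**, and
  hence `necas_ruzicka_sverak_of_rieszPressure : tsai1998_profile_smooth → tsai1998_lemma32 →
  lemarieRieusset_epsilon_regularity → nrs1996_rieszPressure → necas_ruzicka_sverak`.

The Liouville half is literally the argument of `TsaiSelfSimilarPressureProofs` (§2–§5 there,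
Tsai's weighted `L^{5/3}_w` setting) run with the unweighted Hölder inequality on balls: the §2
(testing the profile system) and §3 (Weyl, probe identity, kernel bounds) lemmas of that file are
imported and reused unchanged; §1 and §4 are re-proved here with the exponents of the `L³`
setting (`∫_{B_ϱ} |U| ≲ ϱ²`, `∫_{B_ϱ} |U|² ≲ ϱ`, `∫_{B_ϱ} |Q| ≲ ϱ` for `ϱ ≥ 1`).

## Mathlib / tree search

Mathlib: `ENNReal.lintegral_mul_le_Lp_mul_Lq`, `Measure.addHaar_closedBall`,
`ContDiffBump.ae_convolution_tendsto_right_of_locallyIntegrable` (through the tree's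
`FunctionSpaces.ae_tendsto_normed_convolution`), `is_const_of_fderiv_eq_zero`, `MemLp.ae_eq`. Tree
(all used): `IsLerayProfile.integral_mul_fderiv_pressure`,
`IsLerayProfile.integral_pressure_mul_laplacian_eq_neg_integral_hessian`,
`fderiv_convolution_eq_integral_probe`, `sub_notMem_tsupport_probeBump_convolution`,
`abs_convolution_normed_le`, `abs_integral_le_of_bound_closedBall`, `inv_pow_mul_rpow_le`
(`TsaiSelfSimilarPressureProofs`); `probeBump`, `baseBump`, `baseBumpMass`,
`exists_bound_baseBump_derivs`, `integral_fderiv_mul_comp_sub` (`HarmonicProbe`);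
`nrs1996_lemma31`, `necas_ruzicka_sverak_of_epsilonRegularity` (`NecasRuzickaSverakEpsilon`).
`lean search 'rieszPressure'`: `tsai1998_weightedRieszPressure` and its users (weighted, exponents
`10/3`, `5/3`); the unweighted `L^p` input exists only in test-field form
(`stein1970_normalisedPressure_Lp_bound`, `NormalisedPressureLpBound`, named fact) — no
existence statement for general `U ∈ L^{2q}` with the weak Poisson equation, which is what
Lemma 3.1 consumes.

## References

* J. Nečas, M. Růžička, V. Šverák, *On Leray's self-similar solutions of the Navier–Stokes
  equations*, Acta Math. 176 (1996) 283–294: §2, p. 285, (2.2); Lemma 3.1 and its proof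
  (pp. 287–288) [NecasRuzickaSverak1996].
* T.-P. Tsai, *On Leray's self-similar solutions of the Navier–Stokes equations satisfying local
  energy estimates*, Arch. Rational Mech. Anal. 143 (1998) 29–51: Lemma 2.1, (2.3), (2.5), (2.6)
  (pp. 34–36) [Tsai1998].
* A. P. Calderón, A. Zygmund, *On the existence of certain singular integrals*, Acta Math. 88
  (1952) 85–139 — NRŠ's [CZ] [CalderonZygmund1952].
* E. M. Stein, *Singular integrals and differentiability properties of functions*, Princeton
  (1970), Ch. II–III — NRŠ's [St] [Stein1970].
-/

noncomputable section

open MeasureTheory Set Filter Metric Topology InnerProductSpace Function ContinuousLinearMap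
open scoped ENNReal NNReal RealInnerProductSpace ContDiff Laplacian Convolution

namespace Literature.Analysis.FluidPDE

/-- Local notation for physical space `ℝ³ = EuclideanSpace ℝ (Fin 3)`. -/
local notation "ℝ³" => EuclideanSpace ℝ (Fin 3)

/-! ## The Calderón–Zygmund input (named fact) -/

/-- **The Riesz-transform pressure in `L^q` (Calderón–Zygmund; NRŠ 1996, §2, p. 285).** "If
`U ∈ L^{2q}(ℝⁿ)` for some `q > 1`, we can use the classical Riesz transformation to solve (2.2)
[`−ΔP = ∂ⱼ∂ₖ(UⱼUₖ)`]. … From the classical results regarding the operators `Rⱼ` (see e.g. [CZ]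
or [St]) we infer that `P` defined by `P = RⱼRₖ(UⱼUₖ)` satisfies
`‖P‖_{L^q(ℝⁿ)} ≤ C_q ‖U‖²_{L^{2q}(ℝⁿ)}` and solves (2.2) in the sense of distributions." Rendered
on `ℝ³` (the case used), in existence form and with the norm bound raised to the power `q`
(`∫ |P|^q ≤ C ∫ |U|^{2q}`, `C = C_q^q`): for every `1 < q < ∞` there is `C` such that every
a.e.-strongly measurable `U : ℝ³ → ℝ³` with `∫ |U|^{2q} < ∞` admits an a.e.-strongly measurable
`Q` with `∫ |Q|^q ≤ C ∫ |U|^{2q}` and `∫ Q Δφ = −∫ D²φ(U, U)` for all `φ ∈ C_c^∞(ℝ³)` (the weak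
form of (2.2), cf. Tsai 1998, (2.5)). The `L^q` boundedness of `RⱼRₖ`, `q ≠ 2`, is
Calderón–Zygmund theory, absent from Mathlib; the tree has the `L²` theory
(`NormalisedPressureL2Bound`, proved) and, as a named fact for test fields `w ∈ C_c^∞(ℝ³; ℝ³)`,
the `L^p` bound `‖p̃[w]‖_p ≤ C ‖|w|²‖_p` of the normalised pressure
(`stein1970_normalisedPressure_Lp_bound`, `NormalisedPressureLpBound`), from which the present
statement follows by approximation, polarisation of `w ↦ p̃[w]` and completeness of `L^q` (the
route announced for the weighted twin `tsai1998_weightedRieszPressure` in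
`NormalisedPressurePowerWeightBound`). Named fact. [cite: NecasRuzickaSverak1996, §2 p. 285 (with [CZ], [St])] -/
def nrs1996_rieszPressure : Prop :=
  ∀ q : ℝ, 1 < q → ∃ C : ℝ≥0, ∀ ⦃U : ℝ³ → ℝ³⦄, AEStronglyMeasurable U volume →
    ∫⁻ y, ‖U y‖ₑ ^ (2 * q) < ⊤ →
    ∃ Q : ℝ³ → ℝ, AEStronglyMeasurable Q volume ∧
      ∫⁻ y, ‖Q y‖ₑ ^ q ≤ C * ∫⁻ y, ‖U y‖ₑ ^ (2 * q) ∧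
      ∀ φ : ℝ³ → ℝ, ContDiff ℝ (⊤ : ℕ∞) φ → HasCompactSupport φ →
        ∫ y, Q y * (Δ φ) y = -∫ y, fderiv ℝ (fderiv ℝ φ) y (U y) (U y)

/-! ## §1. Hölder on balls -/

section Holder

variable {G : Type*} [NormedAddCommGroup G]

/-- **Hölder on a ball, `lintegral` form**: for conjugate exponents `p, q`,
`∫_{|x| ≤ ϱ} |F| ≤ (∫ |F|^p)^{1/p} |B_ϱ|^{1/q}`. [folklore] -/
theorem lintegral_enorm_closedBall_le_holder {F : ℝ³ → G} (hF : AEStronglyMeasurable F volume)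
    {p q : ℝ} (hpq : p.HolderConjugate q) (ϱ : ℝ) :
    ∫⁻ x in closedBall (0 : ℝ³) ϱ, ‖F x‖ₑ ≤
      (∫⁻ x, ‖F x‖ₑ ^ p) ^ (1 / p) * (volume (closedBall (0 : ℝ³) ϱ)) ^ (1 / q) := by
  set μ : Measure ℝ³ := volume.restrict (closedBall (0 : ℝ³) ϱ) with hμ
  have hfm : AEMeasurable (fun x => ‖F x‖ₑ) μ := hF.restrict.enorm
  have hgm : AEMeasurable (fun _ : ℝ³ => (1 : ℝ≥0∞)) μ := aemeasurable_const
  have h := ENNReal.lintegral_mul_le_Lp_mul_Lq μ hpq hfm hgm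
  have h1 : ∫⁻ x, ((fun x => ‖F x‖ₑ) * fun _ : ℝ³ => (1 : ℝ≥0∞)) x ∂μ = ∫⁻ x, ‖F x‖ₑ ∂μ :=
    lintegral_congr fun x => by simp
  have h2 : (∫⁻ x, (fun _ : ℝ³ => (1 : ℝ≥0∞)) x ^ q ∂μ) = volume (closedBall (0 : ℝ³) ϱ) := by
    simp [hμ]
  rw [h1, h2] at h
  exact h.trans (mul_le_mul' (ENNReal.rpow_le_rpow (setLIntegral_le_lintegral _ _)
    (one_div_nonneg.2 hpq.left_pos.le)) le_rfl)

/-- **Hölder on a ball, real form**: under `∫ |F|^p < ∞` (`p, q` conjugate), `F` is integrable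
on every ball `B_ϱ = {|x| ≤ ϱ}`, `ϱ > 0`, and `∫_{B_ϱ} |F| ≤ A ϱ^{3/q}` with
`A = (∫ |F|^p)^{1/p} |B₁|^{1/q}` (`|B_ϱ| = ϱ³ |B₁|` on `ℝ³`). [folklore] -/
theorem setIntegral_norm_closedBall_le_holder {F : ℝ³ → G} (hF : AEStronglyMeasurable F volume)
    {p q : ℝ} (hpq : p.HolderConjugate q) (hI : ∫⁻ x, ‖F x‖ₑ ^ p ≠ ⊤) {ϱ : ℝ} (hϱ : 0 < ϱ) :
    IntegrableOn F (closedBall (0 : ℝ³) ϱ) ∧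
      ∫ x in closedBall (0 : ℝ³) ϱ, ‖F x‖ ≤
        ((∫⁻ x, ‖F x‖ₑ ^ p) ^ (1 / p) * volume (ball (0 : ℝ³) 1) ^ (1 / q)).toReal *
          ϱ ^ (3 / q) := by
  have hp : 0 < p := hpq.left_pos
  have hq : 0 < q := hpq.right_pos
  have key := lintegral_enorm_closedBall_le_holder hF hpq ϱ
  have hvol : volume (closedBall (0 : ℝ³) ϱ) = ENNReal.ofReal (ϱ ^ 3) * volume (ball (0 : ℝ³) 1) := by
    rw [Measure.addHaar_closedBall _ _ hϱ.le, finrank_euclideanSpace_fin]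
  have hrhs : (volume (closedBall (0 : ℝ³) ϱ)) ^ (1 / q) =
      volume (ball (0 : ℝ³) 1) ^ (1 / q) * ENNReal.ofReal (ϱ ^ (3 / q)) := by
    rw [hvol, ENNReal.mul_rpow_of_nonneg _ _ (by positivity : (0 : ℝ) ≤ 1 / q),
      ENNReal.ofReal_rpow_of_pos (by positivity : (0 : ℝ) < ϱ ^ 3), ← Real.rpow_natCast ϱ 3,
      ← Real.rpow_mul hϱ.le, mul_comm]
    congr 2
    push_cast
    ring
  set A : ℝ≥0∞ := (∫⁻ x, ‖F x‖ₑ ^ p) ^ (1 / p) * volume (ball (0 : ℝ³) 1) ^ (1 / q) with hA_def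
  have hA : A ≠ ⊤ :=
    ENNReal.mul_ne_top (ENNReal.rpow_ne_top_of_nonneg (by positivity) hI)
      (ENNReal.rpow_ne_top_of_nonneg (by positivity) measure_ball_lt_top.ne)
  have hbound : ∫⁻ x in closedBall (0 : ℝ³) ϱ, ‖F x‖ₑ ≤ A * ENNReal.ofReal (ϱ ^ (3 / q)) := by
    refine key.trans_eq ?_
    rw [hrhs, hA_def, mul_assoc]
  have hfin : ∫⁻ x in closedBall (0 : ℝ³) ϱ, ‖F x‖ₑ < ⊤ :=
    hbound.trans_lt (ENNReal.mul_lt_top hA.lt_top ENNReal.ofReal_lt_top)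
  refine ⟨⟨hF.restrict, hfin⟩, ?_⟩
  rw [integral_norm_eq_lintegral_enorm hF.restrict]
  have h := ENNReal.toReal_mono (ENNReal.mul_ne_top hA ENNReal.ofReal_ne_top) hbound
  rwa [ENNReal.toReal_mul, ENNReal.toReal_ofReal (by positivity)] at h

/-- A function with `∫ |F|^p < ∞`, `1 < p < ∞`, is locally integrable (Hölder on balls).
[folklore] -/
theorem locallyIntegrable_of_holder {F : ℝ³ → G} (hF : AEStronglyMeasurable F volume)
    {p q : ℝ} (hpq : p.HolderConjugate q) (hI : ∫⁻ x, ‖F x‖ₑ ^ p ≠ ⊤) :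
    LocallyIntegrable F volume := by
  refine locallyIntegrable_iff.2 fun k hk => ?_
  obtain ⟨ϱ, hϱ⟩ := hk.isBounded.subset_closedBall (0 : ℝ³)
  have h1 : (0 : ℝ) < max ϱ 1 := lt_max_of_lt_right one_pos
  exact ((setIntegral_norm_closedBall_le_holder hF hpq hI h1).1).mono_set
    (hϱ.trans (closedBall_subset_closedBall (le_max_left _ _)))

end Holder

/-! ## §2. The Liouville step in `L³`: mollifications of `P − Q` have zero gradient -/

section MainEstimate

open TopologicalSpace

variable {ν a : ℝ} {U : ℝ³ → ℝ³} {P : ℝ³ → ℝ}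

/-- **The fixed-scale estimate, `L³` version** (Tsai 1998, p. 35, the displayed chain of
inequalities for `D^αF(0)`, `|α| = 1`, `ε = R⁻¹`, at an arbitrary centre; NRŠ 1996, proof of
Lemma 3.1, pp. 287–288, "this can be done term-by-term, by using integration by parts and the
assumption `U ∈ L³(ℝ³)`, together with the fact `P ∈ L^{3/2}(ℝ³)`"). Let `(U, P)` be a Leray
profile, `Q` locally integrable with `P − Q` weakly harmonic, and suppose the ball bounds
`∫_{B_ϱ} |U| ≤ A_U ϱ²`, `∫_{B_ϱ} |U|² ≤ A_{U²} ϱ`, `∫_{B_ϱ} |Q| ≤ A_Q ϱ` for `ϱ ≥ 1` (Hölder with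
`U ∈ L³`, `Q ∈ L^{3/2}`). Then for every bump `ψ`, centre `y`, direction `e` and probe radius
`R ≥ 1`, the mollification `η = ψ ⋆ (P − Q)` satisfies `|∂ₑη(y)| ≤ K R^{-2/5}` with `K`
independent of `R`. The proof is that of `IsLerayProfile.abs_fderiv_normed_convolution_sub_le`
(`TsaiSelfSimilarPressureProofs`) with the exponents `13/5, 18/5, 11/5` replaced by `2, 3, 1`.
[cite: NecasRuzickaSverak1996, Lemma 3.1 proof (pp. 287–288); Tsai1998, Lemma 2.1 (pp. 35–36)] -/
theorem IsLerayProfile.abs_fderiv_normed_convolution_sub_le_L3 (hprof : IsLerayProfile ν a U P)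
    {Q : ℝ³ → ℝ} (hQl : LocallyIntegrable Q volume)
    (hharm : ∀ φ : ℝ³ → ℝ, ContDiff ℝ (⊤ : ℕ∞) φ → HasCompactSupport φ →
      ∫ x, (P x - Q x) * (Δ φ) x = 0)
    {AU AU2 AQ : ℝ} (hAU0 : 0 ≤ AU) (hAU20 : 0 ≤ AU2) (hAQ0 : 0 ≤ AQ)
    (hballU : ∀ ϱ : ℝ, 1 ≤ ϱ → IntegrableOn U (closedBall (0 : ℝ³) ϱ) ∧
      ∫ x in closedBall (0 : ℝ³) ϱ, ‖U x‖ ≤ AU * ϱ ^ (2 : ℝ))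
    (hballU2 : ∀ ϱ : ℝ, 1 ≤ ϱ → IntegrableOn (fun x => ‖U x‖ ^ 2) (closedBall (0 : ℝ³) ϱ) ∧
      ∫ x in closedBall (0 : ℝ³) ϱ, ‖(‖U x‖ ^ 2)‖ ≤ AU2 * ϱ ^ (1 : ℝ))
    (hballQ : ∀ ϱ : ℝ, 1 ≤ ϱ → IntegrableOn Q (closedBall (0 : ℝ³) ϱ) ∧
      ∫ x in closedBall (0 : ℝ³) ϱ, ‖Q x‖ ≤ AQ * ϱ ^ (1 : ℝ))
    {C₁ C₂ : ℝ} (hC₁ : ∀ x : ℝ³, ‖fderiv ℝ baseBump x‖ ≤ C₁)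
    (hC₂ : ∀ x : ℝ³, |(Δ (baseBump : ℝ³ → ℝ)) x| ≤ C₂) (hC₁0 : 0 ≤ C₁) (hC₂0 : 0 ≤ C₂)
    (ψ : ContDiffBump (0 : ℝ³)) (y e : ℝ³) {R : ℝ} (hR : 1 ≤ R) :
    |fderiv ℝ (ψ.normed volume ⋆[lsmul ℝ ℝ, volume] fun x => P x - Q x) y e| ≤
      ‖e‖ * (baseBumpMass ℝ³)⁻¹ *
        (|ν| * C₂ * AU * (‖y‖ + 2 + ψ.rOut) ^ (2 : ℝ) +
          2 * |a| * AU * (‖y‖ + 2 + ψ.rOut) ^ (2 : ℝ) +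
          |a| * C₁ * AU * (‖y‖ + 2 + ψ.rOut) ^ (3 : ℝ) +
          C₁ * (AU2 + AQ) * (‖y‖ + 2 + ψ.rOut) ^ (1 : ℝ)) * R ^ (-(2 / 5) : ℝ) := by
  have hU2 := hprof.contDiff_velocity
  have hU1 : ContDiff ℝ 1 U := hU2.of_le one_le_two
  have hP1 := hprof.contDiff_pressure
  have hgl : LocallyIntegrable (fun x => P x - Q x) volume := hP1.continuous.locallyIntegrable.sub hQl
  have hm : 0 < baseBumpMass ℝ³ := baseBumpMass_pos
  set m : ℝ := baseBumpMass ℝ³ with hm_def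
  have hd : Module.finrank ℝ ℝ³ = 3 := finrank_euclideanSpace_fin
  have hr : 0 < ψ.rOut := ψ.rOut_pos
  set Λ : ℝ := ‖y‖ + 2 + ψ.rOut with hΛ_def
  have hΛ0 : 0 ≤ Λ := by positivity
  have hR0 : 0 < R := one_pos.trans_le hR
  -- the probe identity (before naming `Ψ`, so that `set` folds it)
  have hprobe := fderiv_convolution_eq_integral_probe hgl hharm ψ hR0 y e
  have hψn : FunctionSpaces.IsTestFunctionOn (⊤ : Opens ℝ³) (ψ.normed volume) :=
    FunctionSpaces.isTestFunctionOn_normed ψ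
  have hψnl : LocallyIntegrable (ψ.normed volume) volume := hψn.contDiff.continuous.locallyIntegrable
  have hDconv : ∀ s v, fderiv ℝ (probeBump R ⋆[lsmul ℝ ℝ, volume] ψ.normed volume) s v =
      ((fun t => fderiv ℝ (probeBump R) t v) ⋆[lsmul ℝ ℝ, volume] ψ.normed volume) s := fun s v =>
    fderiv_convolution_lsmul_apply (contDiff_probeBump R) (hasCompactSupport_probeBump hR0) hψnl s v
  have hΔconv : ∀ s, (Δ (probeBump R ⋆[lsmul ℝ ℝ, volume] ψ.normed volume)) s =
      ((Δ (probeBump R : ℝ³ → ℝ)) ⋆[lsmul ℝ ℝ, volume] ψ.normed volume) s := fun s =>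
    laplacian_convolution_lsmul (contDiff_probeBump R) (hasCompactSupport_probeBump hR0) hψnl s
  have hΨ' : ContDiff ℝ (⊤ : ℕ∞) (probeBump R ⋆[lsmul ℝ ℝ, volume] ψ.normed volume) :=
    (hasCompactSupport_probeBump hR0).contDiff_convolution_left _ (contDiff_probeBump R) hψnl
  have hΨc' : HasCompactSupport (probeBump R ⋆[lsmul ℝ ℝ, volume] ψ.normed volume) :=
    (hasCompactSupport_probeBump hR0).convolution _ ψ.hasCompactSupport_normed
  have hout' : ∀ x : ℝ³, ‖y‖ + (2 * R + ψ.rOut) < ‖x‖ →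
      y - x ∉ tsupport (probeBump R ⋆[lsmul ℝ ℝ, volume] ψ.normed volume) := fun x hx =>
    sub_notMem_tsupport_probeBump_convolution ψ hR0 y hx
  set Ψ : ℝ³ → ℝ := probeBump R ⋆[lsmul ℝ ℝ, volume] ψ.normed volume with hΨ_def
  -- sup bounds `|Ψ| ≤ M₀`, `|DΨ v| ≤ M₁ |v|`, `|ΔΨ| ≤ M₂`
  have hM₀ : ∀ s, |Ψ s| ≤ (m * R ^ 3)⁻¹ := fun s =>
    abs_convolution_normed_le (fun t => by
      have h := abs_probeBump_le hR0 t
      rwa [hd] at h) ψ s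
  have hM₁ : ∀ s v, |fderiv ℝ Ψ s v| ≤ (m * R ^ 3)⁻¹ * R⁻¹ * C₁ * ‖v‖ := fun s v => by
    rw [hDconv s v]
    refine abs_convolution_normed_le (fun t => ?_) ψ s
    have h := norm_fderiv_probeBump_le hR0 hC₁ t
    rw [hd] at h
    calc |fderiv ℝ (probeBump R) t v| ≤ ‖fderiv ℝ (probeBump R) t‖ * ‖v‖ := by
          rw [← Real.norm_eq_abs]; exact le_opNorm _ _
      _ ≤ (m * R ^ 3)⁻¹ * R⁻¹ * C₁ * ‖v‖ := mul_le_mul_of_nonneg_right h (norm_nonneg _)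
  have hM₂ : ∀ s, |(Δ Ψ) s| ≤ (m * R ^ 3)⁻¹ * R⁻¹ ^ 2 * C₂ := fun s => by
    rw [hΔconv s]
    refine abs_convolution_normed_le (fun t => ?_) ψ s
    have h := abs_laplacian_probeBump_le hR0 hC₂ t
    rwa [hd] at h
  set M₀ : ℝ := (m * R ^ 3)⁻¹ with hM₀_def
  set M₁ : ℝ := (m * R ^ 3)⁻¹ * R⁻¹ * C₁ with hM₁_def
  set M₂ : ℝ := (m * R ^ 3)⁻¹ * R⁻¹ ^ 2 * C₂ with hM₂_def
  have hM₀0 : 0 ≤ M₀ := by rw [hM₀_def]; positivity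
  have hM₁0 : 0 ≤ M₁ := by rw [hM₁_def]; positivity
  have hM₂0 : 0 ≤ M₂ := by rw [hM₂_def]; positivity
  have hΨ : ContDiff ℝ (⊤ : ℕ∞) Ψ := hΨ'
  have hΨ2 : ContDiff ℝ 2 Ψ := contDiff_infty.1 hΨ 2
  have hΨ1 : ContDiff ℝ 1 Ψ := contDiff_infty.1 hΨ 1
  have hΨc : HasCompactSupport Ψ := hΨc'
  clear_value M₀ M₁ M₂ Ψ
  -- the split into the `P`- and `Q`-parts
  have hDΨc : HasCompactSupport fun x => fderiv ℝ Ψ (y - x) e :=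
    (hΨc.fderiv_apply (𝕜 := ℝ) e).comp_homeomorph (Homeomorph.subLeft y)
  have hDΨcont : Continuous fun x => fderiv ℝ Ψ (y - x) e :=
    ((hΨ1.continuous_fderiv one_ne_zero).clm_apply continuous_const).comp
      (continuous_const.sub continuous_id)
  have iP : Integrable fun x => fderiv ℝ Ψ (y - x) e * P x :=
    (hDΨcont.mul hP1.continuous).integrable_of_hasCompactSupport hDΨc.mul_right
  have iQ : Integrable fun x => fderiv ℝ Ψ (y - x) e * Q x := by
    simpa only [smul_eq_mul] using hQl.integrable_smul_left_of_hasCompactSupport hDΨcont hDΨc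
  have hsplit : fderiv ℝ (ψ.normed volume ⋆[lsmul ℝ ℝ, volume] fun x => P x - Q x) y e =
      (∫ x, fderiv ℝ Ψ (y - x) e * P x) - ∫ x, fderiv ℝ Ψ (y - x) e * Q x := by
    rw [hprobe, ← integral_sub iP iQ]
    refine integral_congr_ae (ae_of_all _ fun x => ?_)
    ring
  -- the `P`-part: move the derivative to `P`, then use the profile equation
  set θ : ℝ³ → ℝ := fun x => Ψ (y - x) with hθ_def
  have hΨT : FunctionSpaces.IsTestFunctionOn (⊤ : Opens ℝ³) Ψ := ⟨hΨ, hΨc, by simp⟩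
  have hθT : FunctionSpaces.IsTestFunctionOn (⊤ : Opens ℝ³) θ := hΨT.comp_sub_left y
  have hθ2 : ContDiff ℝ 2 θ := contDiff_infty.1 hθT.contDiff 2
  have hP_part : ∫ x, fderiv ℝ Ψ (y - x) e * P x =
      ν * (∫ x, (Δ θ) x * ⟪U x, e⟫) + 2 * a * (∫ x, θ x * ⟪U x, e⟫) +
        a * (∫ x, fderiv ℝ θ x x * ⟪U x, e⟫) + ∫ x, fderiv ℝ θ x (U x) * ⟪U x, e⟫ := by
    rw [← hprof.integral_mul_fderiv_pressure hθ2 hθT.hasCompactSupport e]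
    have h := integral_fderiv_mul_comp_sub hΨ1 hΨc hP1 y e
    have e1 := integral_sub_left_eq_self (fun x => fderiv ℝ Ψ (y - x) e * P x) volume y
    have e2 := integral_sub_left_eq_self (fun x => Ψ (y - x) * fderiv ℝ P x e) volume y
    simp only [sub_sub_cancel] at e1 e2
    rw [← e1, h, e2]
  -- vanishing outside the ball of radius `ϱ`
  set ϱ : ℝ := ‖y‖ + (2 * R + ψ.rOut) with hϱ_def
  have hϱ0 : 0 < ϱ := by positivity
  have hϱ1 : 1 ≤ ϱ := by
    rw [hϱ_def]
    linarith [norm_nonneg y, hr.le]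
  have hϱΛ : ϱ ≤ Λ * R := by
    have h1 : ‖y‖ ≤ ‖y‖ * R := le_mul_of_one_le_right (norm_nonneg _) hR
    have h2 : ψ.rOut ≤ ψ.rOut * R := le_mul_of_one_le_right hr.le hR
    rw [hϱ_def, hΛ_def]
    linarith
  have hout : ∀ x, ϱ < ‖x‖ →
      θ x = 0 ∧ fderiv ℝ θ x = 0 ∧ (Δ θ) x = 0 ∧ fderiv ℝ Ψ (y - x) = 0 := by
    intro x hx
    have hn := hout' x hx
    have h1 : fderiv ℝ Ψ (y - x) = 0 := fderiv_of_notMem_tsupport ℝ hn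
    refine ⟨?_, ?_, ?_, h1⟩
    · show Ψ (y - x) = 0
      exact image_eq_zero_of_notMem_tsupport hn
    · ext v
      rw [hθ_def, FunctionSpaces.fderiv_comp_sub_left_apply hΨ1 y x v, h1]
      simp
    · rw [hθ_def, laplacian_comp_sub_left hΨ2 y x]
      exact FluidPDE.laplacian_eq_zero_of_notMem_tsupport hn
  -- the five bounds
  obtain ⟨hUint, hU13⟩ := hballU ϱ hϱ1
  obtain ⟨hU2int, hU11⟩ := hballU2 ϱ hϱ1
  obtain ⟨hQint, hQ11⟩ := hballQ ϱ hϱ1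
  set I₁ := ∫ x in closedBall (0 : ℝ³) ϱ, ‖U x‖ with hI₁
  set I₂ := ∫ x in closedBall (0 : ℝ³) ϱ, ‖(‖U x‖ ^ 2)‖ with hI₂
  set I₃ := ∫ x in closedBall (0 : ℝ³) ϱ, ‖Q x‖ with hI₃
  have hT1 : |∫ x, (Δ θ) x * ⟪U x, e⟫| ≤ M₂ * ‖e‖ * I₁ := by
    refine abs_integral_le_of_bound_closedBall (fun x => ?_) (fun x hx => ?_) hUint
    · rw [norm_mul, Real.norm_eq_abs, Real.norm_eq_abs]
      calc |(Δ θ) x| * |⟪U x, e⟫| ≤ M₂ * (‖U x‖ * ‖e‖) :=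
            mul_le_mul (by rw [hθ_def, laplacian_comp_sub_left hΨ2 y x]; exact hM₂ _)
              (abs_real_inner_le_norm _ _) (abs_nonneg _) hM₂0
        _ = M₂ * ‖e‖ * ‖U x‖ := by ring
    · rw [(hout x hx).2.2.1, zero_mul]
  have hT2 : |∫ x, θ x * ⟪U x, e⟫| ≤ M₀ * ‖e‖ * I₁ := by
    refine abs_integral_le_of_bound_closedBall (fun x => ?_) (fun x hx => ?_) hUint
    · rw [norm_mul, Real.norm_eq_abs, Real.norm_eq_abs]
      calc |θ x| * |⟪U x, e⟫| ≤ M₀ * (‖U x‖ * ‖e‖) :=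
            mul_le_mul (hM₀ _) (abs_real_inner_le_norm _ _) (abs_nonneg _) hM₀0
        _ = M₀ * ‖e‖ * ‖U x‖ := by ring
    · rw [(hout x hx).1, zero_mul]
  have hT3 : |∫ x, fderiv ℝ θ x x * ⟪U x, e⟫| ≤ M₁ * ϱ * ‖e‖ * I₁ := by
    refine abs_integral_le_of_bound_closedBall (fun x => ?_) (fun x hx => ?_) hUint
    · rw [norm_mul, Real.norm_eq_abs, Real.norm_eq_abs]
      have hDθ : |fderiv ℝ θ x x| ≤ M₁ * ϱ := by
        by_cases hx : ‖x‖ ≤ ϱ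
        · rw [hθ_def, FunctionSpaces.fderiv_comp_sub_left_apply hΨ1 y x x, abs_neg]
          exact (hM₁ _ _).trans (mul_le_mul_of_nonneg_left hx hM₁0)
        · rw [(hout x (not_le.1 hx)).2.1]
          simp only [_root_.zero_apply, abs_zero]
          positivity
      calc |fderiv ℝ θ x x| * |⟪U x, e⟫| ≤ M₁ * ϱ * (‖U x‖ * ‖e‖) :=
            mul_le_mul hDθ (abs_real_inner_le_norm _ _) (abs_nonneg _) (by positivity)
        _ = M₁ * ϱ * ‖e‖ * ‖U x‖ := by ring
    · rw [(hout x hx).2.1, _root_.zero_apply, zero_mul]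
  have hT4 : |∫ x, fderiv ℝ θ x (U x) * ⟪U x, e⟫| ≤ M₁ * ‖e‖ * I₂ := by
    refine abs_integral_le_of_bound_closedBall (fun x => ?_) (fun x hx => ?_) hU2int
    · rw [norm_mul, Real.norm_eq_abs, Real.norm_eq_abs, Real.norm_of_nonneg (sq_nonneg _)]
      have hDθ : |fderiv ℝ θ x (U x)| ≤ M₁ * ‖U x‖ := by
        rw [hθ_def, FunctionSpaces.fderiv_comp_sub_left_apply hΨ1 y x (U x), abs_neg]
        exact hM₁ _ _
      calc |fderiv ℝ θ x (U x)| * |⟪U x, e⟫| ≤ M₁ * ‖U x‖ * (‖U x‖ * ‖e‖) :=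
            mul_le_mul hDθ (abs_real_inner_le_norm _ _) (abs_nonneg _) (by positivity)
        _ = M₁ * ‖e‖ * ‖U x‖ ^ 2 := by ring
    · rw [(hout x hx).2.1, _root_.zero_apply, zero_mul]
  have hT5 : |∫ x, fderiv ℝ Ψ (y - x) e * Q x| ≤ M₁ * ‖e‖ * I₃ := by
    refine abs_integral_le_of_bound_closedBall (fun x => ?_) (fun x hx => ?_) hQint
    · rw [norm_mul, Real.norm_eq_abs]
      exact mul_le_mul_of_nonneg_right (hM₁ _ _) (norm_nonneg _)
    · rw [(hout x hx).2.2.2, _root_.zero_apply, zero_mul]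
  clear_value I₁ I₂ I₃
  -- scaling: every term is `O(R^{-2/5})`
  have hmR : (m * R ^ 3)⁻¹ = m⁻¹ * (R ^ 3)⁻¹ := mul_inv _ _
  have hR3 : (R ^ 3)⁻¹ * R⁻¹ = (R ^ 4)⁻¹ := by
    rw [← mul_inv, ← pow_succ]
  have hR5 : (R ^ 3)⁻¹ * R⁻¹ ^ 2 = (R ^ 5)⁻¹ := by
    rw [inv_pow, ← mul_inv, ← pow_add]
  have b0 : M₀ * ϱ ^ (2 : ℝ) ≤ m⁻¹ * (Λ ^ (2 : ℝ) * R ^ (-(2 / 5) : ℝ)) := by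
    have h := inv_pow_mul_rpow_le (n := 3) (s := 2) hR hΛ0 hϱ0.le hϱΛ (by norm_num)
      (by norm_num)
    calc M₀ * ϱ ^ (2 : ℝ) = m⁻¹ * ((R ^ 3)⁻¹ * ϱ ^ (2 : ℝ)) := by
          rw [hM₀_def, hmR, mul_assoc]
      _ ≤ m⁻¹ * (Λ ^ (2 : ℝ) * R ^ (-(2 / 5) : ℝ)) :=
          mul_le_mul_of_nonneg_left h (inv_nonneg.2 hm.le)
  have b2 : M₂ * ϱ ^ (2 : ℝ) ≤ m⁻¹ * C₂ * (Λ ^ (2 : ℝ) * R ^ (-(2 / 5) : ℝ)) := by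
    have h := inv_pow_mul_rpow_le (n := 5) (s := 2) hR hΛ0 hϱ0.le hϱΛ (by norm_num)
      (by norm_num)
    calc M₂ * ϱ ^ (2 : ℝ) = m⁻¹ * C₂ * ((R ^ 5)⁻¹ * ϱ ^ (2 : ℝ)) := by
          rw [hM₂_def, hmR, mul_assoc m⁻¹, hR5]; ring
      _ ≤ m⁻¹ * C₂ * (Λ ^ (2 : ℝ) * R ^ (-(2 / 5) : ℝ)) :=
          mul_le_mul_of_nonneg_left h (by positivity)
  have b1 : M₁ * ϱ * ϱ ^ (2 : ℝ) ≤ m⁻¹ * C₁ * (Λ ^ (3 : ℝ) * R ^ (-(2 / 5) : ℝ)) := by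
    have h := inv_pow_mul_rpow_le (n := 4) (s := 3) hR hΛ0 hϱ0.le hϱΛ (by norm_num)
      (by norm_num)
    have hϱpow : ϱ * ϱ ^ (2 : ℝ) = ϱ ^ (3 : ℝ) := by
      rw [show (3 : ℝ) = 1 + 2 by norm_num, Real.rpow_add hϱ0, Real.rpow_one]
    calc M₁ * ϱ * ϱ ^ (2 : ℝ) = m⁻¹ * C₁ * ((R ^ 4)⁻¹ * ϱ ^ (3 : ℝ)) := by
          rw [mul_assoc, hϱpow, hM₁_def, hmR, mul_assoc m⁻¹, hR3]; ring
      _ ≤ m⁻¹ * C₁ * (Λ ^ (3 : ℝ) * R ^ (-(2 / 5) : ℝ)) :=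
          mul_le_mul_of_nonneg_left h (by positivity)
  have b1' : M₁ * ϱ ^ (1 : ℝ) ≤ m⁻¹ * C₁ * (Λ ^ (1 : ℝ) * R ^ (-(2 / 5) : ℝ)) := by
    have h := inv_pow_mul_rpow_le (n := 4) (s := 1) hR hΛ0 hϱ0.le hϱΛ (by norm_num)
      (by norm_num)
    calc M₁ * ϱ ^ (1 : ℝ) = m⁻¹ * C₁ * ((R ^ 4)⁻¹ * ϱ ^ (1 : ℝ)) := by
          rw [hM₁_def, hmR, mul_assoc m⁻¹, hR3]; ring
      _ ≤ m⁻¹ * C₁ * (Λ ^ (1 : ℝ) * R ^ (-(2 / 5) : ℝ)) :=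
          mul_le_mul_of_nonneg_left h (by positivity)
  -- assemble
  have hI₁ : I₁ ≤ AU * ϱ ^ (2 : ℝ) := hU13
  have hI₂ : I₂ ≤ AU2 * ϱ ^ (1 : ℝ) := hU11
  have hI₃ : I₃ ≤ AQ * ϱ ^ (1 : ℝ) := hQ11
  have he : 0 ≤ ‖e‖ := norm_nonneg e
  have t1 : |ν| * |∫ x, (Δ θ) x * ⟪U x, e⟫| ≤
      |ν| * ‖e‖ * AU * (m⁻¹ * C₂ * (Λ ^ (2 : ℝ) * R ^ (-(2 / 5) : ℝ))) :=
    calc |ν| * |∫ x, (Δ θ) x * ⟪U x, e⟫| ≤ |ν| * (M₂ * ‖e‖ * (AU * ϱ ^ (2 : ℝ))) :=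
          mul_le_mul_of_nonneg_left
            (hT1.trans (mul_le_mul_of_nonneg_left hI₁ (mul_nonneg hM₂0 he))) (abs_nonneg _)
      _ = |ν| * ‖e‖ * AU * (M₂ * ϱ ^ (2 : ℝ)) := by ring
      _ ≤ |ν| * ‖e‖ * AU * (m⁻¹ * C₂ * (Λ ^ (2 : ℝ) * R ^ (-(2 / 5) : ℝ))) :=
          mul_le_mul_of_nonneg_left b2 (by positivity)
  have t2 : 2 * |a| * |∫ x, θ x * ⟪U x, e⟫| ≤
      2 * |a| * ‖e‖ * AU * (m⁻¹ * (Λ ^ (2 : ℝ) * R ^ (-(2 / 5) : ℝ))) :=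
    calc 2 * |a| * |∫ x, θ x * ⟪U x, e⟫| ≤ 2 * |a| * (M₀ * ‖e‖ * (AU * ϱ ^ (2 : ℝ))) :=
          mul_le_mul_of_nonneg_left
            (hT2.trans (mul_le_mul_of_nonneg_left hI₁ (mul_nonneg hM₀0 he))) (by positivity)
      _ = 2 * |a| * ‖e‖ * AU * (M₀ * ϱ ^ (2 : ℝ)) := by ring
      _ ≤ 2 * |a| * ‖e‖ * AU * (m⁻¹ * (Λ ^ (2 : ℝ) * R ^ (-(2 / 5) : ℝ))) :=
          mul_le_mul_of_nonneg_left b0 (by positivity)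
  have t3 : |a| * |∫ x, fderiv ℝ θ x x * ⟪U x, e⟫| ≤
      |a| * ‖e‖ * AU * (m⁻¹ * C₁ * (Λ ^ (3 : ℝ) * R ^ (-(2 / 5) : ℝ))) :=
    calc |a| * |∫ x, fderiv ℝ θ x x * ⟪U x, e⟫| ≤
        |a| * (M₁ * ϱ * ‖e‖ * (AU * ϱ ^ (2 : ℝ))) :=
          mul_le_mul_of_nonneg_left
            (hT3.trans (mul_le_mul_of_nonneg_left hI₁ (by positivity))) (abs_nonneg _)
      _ = |a| * ‖e‖ * AU * (M₁ * ϱ * ϱ ^ (2 : ℝ)) := by ring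
      _ ≤ |a| * ‖e‖ * AU * (m⁻¹ * C₁ * (Λ ^ (3 : ℝ) * R ^ (-(2 / 5) : ℝ))) :=
          mul_le_mul_of_nonneg_left b1 (by positivity)
  have t4 : |∫ x, fderiv ℝ θ x (U x) * ⟪U x, e⟫| ≤
      ‖e‖ * AU2 * (m⁻¹ * C₁ * (Λ ^ (1 : ℝ) * R ^ (-(2 / 5) : ℝ))) :=
    calc |∫ x, fderiv ℝ θ x (U x) * ⟪U x, e⟫| ≤ M₁ * ‖e‖ * (AU2 * ϱ ^ (1 : ℝ)) :=
          hT4.trans (mul_le_mul_of_nonneg_left hI₂ (mul_nonneg hM₁0 he))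
      _ = ‖e‖ * AU2 * (M₁ * ϱ ^ (1 : ℝ)) := by ring
      _ ≤ ‖e‖ * AU2 * (m⁻¹ * C₁ * (Λ ^ (1 : ℝ) * R ^ (-(2 / 5) : ℝ))) :=
          mul_le_mul_of_nonneg_left b1' (by positivity)
  have t5 : |∫ x, fderiv ℝ Ψ (y - x) e * Q x| ≤
      ‖e‖ * AQ * (m⁻¹ * C₁ * (Λ ^ (1 : ℝ) * R ^ (-(2 / 5) : ℝ))) :=
    calc |∫ x, fderiv ℝ Ψ (y - x) e * Q x| ≤ M₁ * ‖e‖ * (AQ * ϱ ^ (1 : ℝ)) :=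
          hT5.trans (mul_le_mul_of_nonneg_left hI₃ (mul_nonneg hM₁0 he))
      _ = ‖e‖ * AQ * (M₁ * ϱ ^ (1 : ℝ)) := by ring
      _ ≤ ‖e‖ * AQ * (m⁻¹ * C₁ * (Λ ^ (1 : ℝ) * R ^ (-(2 / 5) : ℝ))) :=
          mul_le_mul_of_nonneg_left b1' (by positivity)
  have htri : |ν * (∫ x, (Δ θ) x * ⟪U x, e⟫) + 2 * a * (∫ x, θ x * ⟪U x, e⟫) +
        a * (∫ x, fderiv ℝ θ x x * ⟪U x, e⟫) + (∫ x, fderiv ℝ θ x (U x) * ⟪U x, e⟫) -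
        ∫ x, fderiv ℝ Ψ (y - x) e * Q x| ≤
      |ν| * |∫ x, (Δ θ) x * ⟪U x, e⟫| + 2 * |a| * |∫ x, θ x * ⟪U x, e⟫| +
        |a| * |∫ x, fderiv ℝ θ x x * ⟪U x, e⟫| + |∫ x, fderiv ℝ θ x (U x) * ⟪U x, e⟫| +
        |∫ x, fderiv ℝ Ψ (y - x) e * Q x| := by
    refine (abs_sub _ _).trans (add_le_add ?_ le_rfl)
    refine (abs_add_le _ _).trans (add_le_add ?_ le_rfl)
    refine (abs_add_le _ _).trans (add_le_add ((abs_add_le _ _).trans (add_le_add ?_ ?_)) ?_)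
    · rw [abs_mul]
    · rw [abs_mul, abs_mul, abs_two]
    · rw [abs_mul]
  have hKR : ‖e‖ * m⁻¹ * (|ν| * C₂ * AU * Λ ^ (2 : ℝ) + 2 * |a| * AU * Λ ^ (2 : ℝ) +
        |a| * C₁ * AU * Λ ^ (3 : ℝ) + C₁ * (AU2 + AQ) * Λ ^ (1 : ℝ)) * R ^ (-(2 / 5) : ℝ) =
      |ν| * ‖e‖ * AU * (m⁻¹ * C₂ * (Λ ^ (2 : ℝ) * R ^ (-(2 / 5) : ℝ))) +
      2 * |a| * ‖e‖ * AU * (m⁻¹ * (Λ ^ (2 : ℝ) * R ^ (-(2 / 5) : ℝ))) +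
      |a| * ‖e‖ * AU * (m⁻¹ * C₁ * (Λ ^ (3 : ℝ) * R ^ (-(2 / 5) : ℝ))) +
      ‖e‖ * AU2 * (m⁻¹ * C₁ * (Λ ^ (1 : ℝ) * R ^ (-(2 / 5) : ℝ))) +
      ‖e‖ * AQ * (m⁻¹ * C₁ * (Λ ^ (1 : ℝ) * R ^ (-(2 / 5) : ℝ))) := by
    ring
  rw [hsplit, hP_part, hKR]
  linarith only [htri, t1, t2, t3, t4, t5]

/-- **The Liouville step in `L³` (NRŠ 1996, proof of (3.1), pp. 287–288; Tsai 1998, Lemma 2.1,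
last assertion, pp. 35–36): mollifications of `P − Q` have zero gradient.** Let `(U, P)` be a
Leray profile with `∫ |U|³ < ∞` and let `Q ∈ L^{3/2}` solve `−ΔQ = ∂ᵢ∂ⱼ(UᵢUⱼ)` in `𝒟'`. Then
for every bump `ψ` the mollification `ψ ⋆ (P − Q)` (a smooth harmonic function) has identically
vanishing gradient: by the fixed-scale estimate `|∂ₑ(ψ ⋆ (P − Q))(y)| ≤ K R^{-2/5}` for every
probe radius `R ≥ 1`, and `R → ∞`. [cite: NecasRuzickaSverak1996, Lemma 3.1 proof (pp. 287–288); Tsai1998, Lemma 2.1 (pp. 35–36)] -/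
theorem IsLerayProfile.fderiv_normed_convolution_sub_eq_zero_L3 (hprof : IsLerayProfile ν a U P)
    (hIU : ∫⁻ y, ‖U y‖ₑ ^ (3 : ℝ) ≠ ⊤)
    {Q : ℝ³ → ℝ} (hQm : AEStronglyMeasurable Q volume)
    (hIQ : ∫⁻ y, ‖Q y‖ₑ ^ (3 / 2 : ℝ) ≠ ⊤)
    (hQ : ∀ φ : ℝ³ → ℝ, ContDiff ℝ (⊤ : ℕ∞) φ → HasCompactSupport φ →
      ∫ y, Q y * (Δ φ) y = -∫ y, fderiv ℝ (fderiv ℝ φ) y (U y) (U y))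
    (ψ : ContDiffBump (0 : ℝ³)) (y e : ℝ³) :
    fderiv ℝ (ψ.normed volume ⋆[lsmul ℝ ℝ, volume] fun x => P x - Q x) y e = 0 := by
  -- exponents and basic regularity
  have hpq₁ : (3 : ℝ).HolderConjugate (3 / 2) := ⟨by norm_num, by norm_num, by norm_num⟩
  have hpq₂ : (3 / 2 : ℝ).HolderConjugate 3 := ⟨by norm_num, by norm_num, by norm_num⟩
  have hU1 : ContDiff ℝ 1 U := hprof.contDiff_velocity.of_le one_le_two
  have hP1 := hprof.contDiff_pressure
  have hUm : AEStronglyMeasurable U volume := hU1.continuous.aestronglyMeasurable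
  have hU2m : AEStronglyMeasurable (fun x => ‖U x‖ ^ 2) volume :=
    (hU1.continuous.norm.pow 2).aestronglyMeasurable
  have hIU2 : ∫⁻ x, ‖(‖U x‖ ^ 2)‖ₑ ^ (3 / 2 : ℝ) ≠ ⊤ := by
    have h : ∀ x, ‖(‖U x‖ ^ 2)‖ₑ ^ (3 / 2 : ℝ) = ‖U x‖ₑ ^ (3 : ℝ) := fun x => by
      rw [Real.enorm_eq_ofReal (sq_nonneg _), ENNReal.ofReal_pow (norm_nonneg _), ofReal_norm,
        ← ENNReal.rpow_natCast, ← ENNReal.rpow_mul]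
      norm_num
    simp_rw [h]
    exact hIU
  -- the three ball bounds (Hölder on balls of radius `ϱ ≥ 1`)
  have hballU : ∀ ϱ : ℝ, 1 ≤ ϱ → IntegrableOn U (closedBall (0 : ℝ³) ϱ) ∧
      ∫ x in closedBall (0 : ℝ³) ϱ, ‖U x‖ ≤
        ((∫⁻ x, ‖U x‖ₑ ^ (3 : ℝ)) ^ (1 / (3 : ℝ)) *
          volume (ball (0 : ℝ³) 1) ^ (1 / (3 / 2 : ℝ))).toReal * ϱ ^ (2 : ℝ) := fun ϱ hϱ => by
    have h := setIntegral_norm_closedBall_le_holder hUm hpq₁ hIU (one_pos.trans_le hϱ)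
    exact ⟨h.1, h.2.trans_eq (by norm_num)⟩
  have hballU2 : ∀ ϱ : ℝ, 1 ≤ ϱ → IntegrableOn (fun x => ‖U x‖ ^ 2) (closedBall (0 : ℝ³) ϱ) ∧
      ∫ x in closedBall (0 : ℝ³) ϱ, ‖(‖U x‖ ^ 2)‖ ≤
        ((∫⁻ x, ‖(‖U x‖ ^ 2)‖ₑ ^ (3 / 2 : ℝ)) ^ (1 / (3 / 2 : ℝ)) *
          volume (ball (0 : ℝ³) 1) ^ (1 / (3 : ℝ))).toReal * ϱ ^ (1 : ℝ) := fun ϱ hϱ => by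
    have h := setIntegral_norm_closedBall_le_holder hU2m hpq₂ hIU2 (one_pos.trans_le hϱ)
    exact ⟨h.1, h.2.trans_eq (by norm_num)⟩
  have hballQ : ∀ ϱ : ℝ, 1 ≤ ϱ → IntegrableOn Q (closedBall (0 : ℝ³) ϱ) ∧
      ∫ x in closedBall (0 : ℝ³) ϱ, ‖Q x‖ ≤
        ((∫⁻ x, ‖Q x‖ₑ ^ (3 / 2 : ℝ)) ^ (1 / (3 / 2 : ℝ)) *
          volume (ball (0 : ℝ³) 1) ^ (1 / (3 : ℝ))).toReal * ϱ ^ (1 : ℝ) := fun ϱ hϱ => by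
    have h := setIntegral_norm_closedBall_le_holder hQm hpq₂ hIQ (one_pos.trans_le hϱ)
    exact ⟨h.1, h.2.trans_eq (by norm_num)⟩
  -- `P - Q` is weakly harmonic
  have hQl : LocallyIntegrable Q volume := locallyIntegrable_of_holder hQm hpq₂ hIQ
  have hharm : ∀ φ : ℝ³ → ℝ, ContDiff ℝ (⊤ : ℕ∞) φ → HasCompactSupport φ →
      ∫ x, (P x - Q x) * (Δ φ) x = 0 := by
    intro φ hφ hφc
    have hΔc : Continuous (Δ φ) := FluidPDE.continuous_laplacian (contDiff_infty.1 hφ 2)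
    have hΔs : HasCompactSupport (Δ φ) :=
      hφc.mono' fun x hx => by
        contrapose! hx
        simp [FluidPDE.laplacian_eq_zero_of_notMem_tsupport hx]
    have i1 : Integrable fun x => P x * (Δ φ) x :=
      (hP1.continuous.mul hΔc).integrable_of_hasCompactSupport hΔs.mul_left
    have i2 : Integrable fun x => Q x * (Δ φ) x := by
      simpa only [smul_eq_mul] using hQl.integrable_smul_right_of_hasCompactSupport hΔc hΔs
    simp_rw [sub_mul]
    rw [integral_sub i1 i2, hprof.integral_pressure_mul_laplacian_eq_neg_integral_hessian hφ hφc,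
      hQ φ hφ hφc, sub_self]
  -- constants and the fixed-scale estimate
  obtain ⟨⟨C₁, hC₁⟩, ⟨C₂, hC₂⟩⟩ := exists_bound_baseBump_derivs (E := ℝ³)
  have hC₁0 : 0 ≤ C₁ := (norm_nonneg _).trans (hC₁ 0)
  have hC₂0 : 0 ≤ C₂ := (abs_nonneg _).trans (hC₂ 0)
  obtain ⟨K, hK⟩ : ∃ K : ℝ, ∀ R : ℝ, 1 ≤ R →
      |fderiv ℝ (ψ.normed volume ⋆[lsmul ℝ ℝ, volume] fun x => P x - Q x) y e| ≤
        K * R ^ (-(2 / 5) : ℝ) :=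
    ⟨_, fun R hR => hprof.abs_fderiv_normed_convolution_sub_le_L3 hQl hharm ENNReal.toReal_nonneg
      ENNReal.toReal_nonneg ENNReal.toReal_nonneg hballU hballU2 hballQ hC₁ hC₂ hC₁0 hC₂0 ψ y e hR⟩
  -- let `R → ∞`
  have hlim : Tendsto (fun R : ℝ => K * R ^ (-(2 / 5) : ℝ)) atTop (𝓝 0) := by
    simpa using (tendsto_rpow_neg_atTop (by norm_num : (0 : ℝ) < 2 / 5)).const_mul K
  have hle : |fderiv ℝ (ψ.normed volume ⋆[lsmul ℝ ℝ, volume] fun x => P x - Q x) y e| ≤ 0 :=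
    ge_of_tendsto hlim (eventually_atTop.2 ⟨1, fun R hR => hK R hR⟩)
  exact abs_nonpos_iff.1 hle


end MainEstimate

/-! ## §3. `P − Q` is constant; Lemma 3.1 and Theorem 1 from the Riesz pressure -/

section Assembly

variable {ν a : ℝ} {U : ℝ³ → ℝ³} {P : ℝ³ → ℝ}

/-- **NRŠ 1996, Lemma 3.1, Liouville half** ((3.1), pp. 287–288: the given pressure and the
Riesz pressure differ by a constant), for the tree's profile class: let `(U, P)` be a Leray
profile with `∫ |U|³ < ∞` and let `Q ∈ L^{3/2}` (a.e.-strongly measurable, `∫ |Q|^{3/2} < ∞`)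
solve `−ΔQ = ∂ᵢ∂ⱼ(UᵢUⱼ)` in `𝒟'(ℝ³)`. Then `P − Q` is a.e. equal to a constant: every
mollification `φₖ ⋆ (P − Q)` has zero gradient (`fderiv_normed_convolution_sub_eq_zero_L3`),
hence is constant, and `φₖ ⋆ (P − Q) → P − Q` a.e. along a mollifier sequence.
[cite: NecasRuzickaSverak1996, Lemma 3.1 (p. 287)] -/
theorem IsLerayProfile.exists_sub_ae_eq_const_L3 (hprof : IsLerayProfile ν a U P)
    (hIU : ∫⁻ y, ‖U y‖ₑ ^ (3 : ℝ) ≠ ⊤)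
    {Q : ℝ³ → ℝ} (hQm : AEStronglyMeasurable Q volume)
    (hIQ : ∫⁻ y, ‖Q y‖ₑ ^ (3 / 2 : ℝ) ≠ ⊤)
    (hQ : ∀ φ : ℝ³ → ℝ, ContDiff ℝ (⊤ : ℕ∞) φ → HasCompactSupport φ →
      ∫ y, Q y * (Δ φ) y = -∫ y, fderiv ℝ (fderiv ℝ φ) y (U y) (U y)) :
    ∃ c : ℝ, ∀ᵐ x ∂(volume : Measure ℝ³), P x - Q x = c := by
  have hpq₂ : (3 / 2 : ℝ).HolderConjugate 3 := ⟨by norm_num, by norm_num, by norm_num⟩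
  have hQl : LocallyIntegrable Q volume := locallyIntegrable_of_holder hQm hpq₂ hIQ
  set g : ℝ³ → ℝ := fun x => P x - Q x with hg_def
  have hgl : LocallyIntegrable g volume :=
    hprof.contDiff_pressure.continuous.locallyIntegrable.sub hQl
  obtain ⟨φ, hφ0, hφ2⟩ := FunctionSpaces.exists_contDiffBump_seq (E := ℝ³)
  -- each mollification is constant
  have hconst : ∀ k x, ((φ k).normed volume ⋆[lsmul ℝ ℝ, volume] g) x =
      ((φ k).normed volume ⋆[lsmul ℝ ℝ, volume] g) 0 := by
    intro k x
    have hdiff : Differentiable ℝ ((φ k).normed volume ⋆[lsmul ℝ ℝ, volume] g) :=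
      ((φ k).hasCompactSupport_normed.contDiff_convolution_left _
        ((φ k).contDiff_normed (n := 1)) hgl).differentiable one_ne_zero
    have hzero : ∀ y, fderiv ℝ ((φ k).normed volume ⋆[lsmul ℝ ℝ, volume] g) y = 0 := fun y => by
      ext e
      exact hprof.fderiv_normed_convolution_sub_eq_zero_L3 hIU hQm hIQ hQ (φ k) y e
    exact is_const_of_fderiv_eq_zero hdiff hzero x 0
  have hlim := FunctionSpaces.ae_tendsto_normed_convolution hφ0 hφ2 hgl
  refine ⟨limUnder atTop fun k => ((φ k).normed volume ⋆[lsmul ℝ ℝ, volume] g) 0, ?_⟩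
  filter_upwards [hlim] with x hx
  simp_rw [hconst _ x] at hx
  exact hx.limUnder_eq.symm


/-- `∫ |U|³ < ∞` (real exponent) for `U ∈ L³`. [folklore] -/
theorem lintegral_enorm_rpow_three_lt_top {U : ℝ³ → ℝ³} (hU : MemLp U 3 volume) :
    ∫⁻ y, ‖U y‖ₑ ^ (3 : ℝ) < ⊤ := by
  have h := hU.2
  rw [eLpNorm_lt_top_iff_lintegral_rpow_enorm_lt_top (by norm_num) (by simp),
    ENNReal.toReal_ofNat] at h
  exact h

/-- **NRŠ 1996, Lemma 3.1 from the Riesz pressure**: the named fact `nrs1996_lemma31` (an `L³`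
Leray profile has a constant `c` with `P − c ∈ L^{3/2}`) follows from the Calderón–Zygmund fact
`nrs1996_rieszPressure` (with `q = 3/2`): take `Q` from the fact, then `P − Q = c` a.e. by
`exists_sub_ae_eq_const_L3`, so `P − c = Q ∈ L^{3/2}` a.e. This is the whole printed proof of
Lemma 3.1 except the sentence invoking [CZ], [St], which is the hypothesis.
[cite: NecasRuzickaSverak1996, Lemma 3.1 (p. 287) with §2 p. 285] -/
theorem nrs1996_lemma31_of_rieszPressure (h : nrs1996_rieszPressure) : nrs1996_lemma31 := by
  intro ν a hν ha U P hprof hU3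
  obtain ⟨C, hC⟩ := h (3 / 2) (by norm_num)
  have hUm : AEStronglyMeasurable U volume := hprof.contDiff_velocity.continuous.aestronglyMeasurable
  have hIU : ∫⁻ y, ‖U y‖ₑ ^ (3 : ℝ) < ⊤ := lintegral_enorm_rpow_three_lt_top hU3
  have h23 : (2 : ℝ) * (3 / 2) = 3 := by norm_num
  have hIU' : ∫⁻ y, ‖U y‖ₑ ^ (2 * (3 / 2 : ℝ)) < ⊤ := by rwa [h23]
  obtain ⟨Q, hQm, hQbound, hQeq⟩ := hC hUm hIU'
  rw [h23] at hQbound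
  have hIQ : ∫⁻ y, ‖Q y‖ₑ ^ (3 / 2 : ℝ) ≠ ⊤ :=
    (hQbound.trans_lt (ENNReal.mul_lt_top ENNReal.coe_lt_top hIU)).ne
  obtain ⟨c, hc⟩ := hprof.exists_sub_ae_eq_const_L3 hIU.ne hQm hIQ hQeq
  refine ⟨c, ?_⟩
  have hQLp : MemLp Q (3 / 2 : ℝ≥0∞) volume := by
    refine ⟨hQm, ?_⟩
    have h0 : (3 / 2 : ℝ≥0∞) ≠ 0 := by norm_num
    have htop : (3 / 2 : ℝ≥0∞) ≠ ⊤ := by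
      rw [Ne, ENNReal.div_eq_top]
      norm_num
    rw [eLpNorm_lt_top_iff_lintegral_rpow_enorm_lt_top h0 htop]
    have h32 : (3 / 2 : ℝ≥0∞).toReal = 3 / 2 := by
      rw [ENNReal.toReal_div, ENNReal.toReal_ofNat, ENNReal.toReal_ofNat]
    rw [h32]
    exact hIQ.lt_top
  refine hQLp.ae_eq ?_
  filter_upwards [hc] with y hy
  show Q y = P y - c
  linarith

/-- **NRŠ 1996, Theorem 1, from standard inputs only.** Every Leray profile `U ∈ L³(ℝ³)`
vanishes (`necas_ruzicka_sverak`), granted the regularity of weak solutions of (1.3)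
(`tsai1998_profile_smooth`), the polynomial growth of the pressure (`tsai1998_lemma32`), the
one-scale Caffarelli–Kohn–Nirenberg criterion (`lemarieRieusset_epsilon_regularity`) and the
`L^q` boundedness of the Riesz transforms in the form `nrs1996_rieszPressure`; everything else
(Lemma 3.1's Liouville half, (3.5)–(3.6) for `k = 0`, (3.3), Lemma 3.3, the maximum-principle
endgame and the harmonic Liouville theorem) is proved in the tree.
[cite: NecasRuzickaSverak1996, Thm 1 (p. 291)] -/
theorem necas_ruzicka_sverak_of_rieszPressure (hreg : tsai1998_profile_smooth)
    (h32 : tsai1998_lemma32) (hLR : lemarieRieusset_epsilon_regularity)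
    (hR : nrs1996_rieszPressure) : necas_ruzicka_sverak :=
  necas_ruzicka_sverak_of_epsilonRegularity hreg h32 hLR (nrs1996_lemma31_of_rieszPressure hR)

end Assembly

end Literature.Analysis.FluidPDE

end
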